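import Literature.IUT.HodgeTheaters.PuncturedEllipticProLModelTransfer
import Literature.IUT.HodgeTheaters.PuncturedEllipticCoveringsCor12InertiaCentralOfCuspGalois
import HarnessLib

/-!
# An infinite pro-`l` model of [IUTchI] §1, part 15: the cusp labels are INJECTIVE — (L2a) (L2c) with NO extra law

Mochizuki, *Inter-universal Teichmüller theory I*, kurims manuscript (May 2020), §1 p. 37 l. 30–36 («`0 → I_ε′ × I_ε″ → Δ_ε`
… `I_ε′ ≅ ℤ/lℤ`») and p. 38 l. 22–24 («the natural action of `G_k` on `Δ_ε⁺` is trivial») ([IUTchI] §1 p.37)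
[claim: Mochizuki2012, status: disputed]; classical input [AbsTopI] Lemma 4.5 (i) p. 54 [cite: MochizukiAbsTopI2012, Lemma
4.5 (i) p.54].  (D-0012 claim key; series status DISPUTED — PROOF-ONLY module; nothing of the series is asserted, no side is
taken on [IUTchIII] Cor. 3.12.)

Cell abc-iut, seat abc-iut-L5-d4 (gen 12), row R45.  Part 14 derived (L2a) (L2c) at a genuine `GeomOrigin` datum modulo the
law (I) «distinct cusps have non-`Π_X̲`-conjugate inertia».  THIS FILE REMOVES (I): the shadow labels
`κ x = (F g_x)·0 ∈ ℤ/l` are SURJECTIVE — the cusp `a^i · x₀` has label `i + κ x₀`, because `I_{a^i·x₀}` is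
`Π_X̲`-conjugate to `a^i I_{x₀} a^{−i}` (`CuspGalois.act_decomp`) and `Π_X̲`-conjugation does not move inertia modulo
`Ker(Δ_X̲ ↠ Δ_X̲^{ab} ⊗ ℤ/l)` by (L4), which is abc-iut-w4-d051/abc-iut-L5-t1's THEOREM `GeomOrigin.inertia_central O C`
(from the field (∗)) — hence injective (`#Cusp = l`).  Consequently:
* **`GeomOrigin.inertia_ε1_image_order_of_cuspGalois (O) (C) (hl) (hX)`** = (L2a) and
  **`GeomOrigin.inertia_images_inf_le_of_cuspGalois (O) (C) (hl) (hX)`** = (L2c) at a genuine datum from the origin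
  record (A) (c′), a cusp action, `l` prime and `[Π_X : Π_X̲] = l` ONLY;
* `GeomOrigin.inertia_conj_injective (O) (C) (hl) (hX)` — the law (I) itself is a THEOREM of the same data.
HONEST LABEL: a DERIVATION over OUR interfaces; no `sorry`; nothing of [IUTchI] is asserted.
-/

noncomputable section

namespace Literature.IUT.HodgeTheaters

namespace PuncturedEllipticData

universe u

namespace ProLModel

open DihedralGroup _root_.Topology Literature.AnabelianGeometry.AbsoluteAnabelian
open scoped Pointwise

variable (l : ℕ) [Fact l.Prime]

/-! ### Model: distinct lines stay distinct modulo `Ker` -/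

/-- `(c_k)` does not lie in `Ker(Π_X̲ ↠ Π_X̲^{ab} ⊗ ℤ/l)` (its `B_k`-coordinate is `−1`). [claim: Mochizuki2012, status: disputed] -/
theorem inN_cvec_not_mem_modLKer (h5 : 5 ≤ l) (k : ZMod l) : inN l (cvec l k) ∉ (datum l h5).modLKer := by
  intro h
  have hk := ((mem_modLKer_datum_iff l h5 _).1 h).2.1 k
  haveI : Fact (1 < l) := ⟨(Fact.out : l.Prime).one_lt⟩
  have h1 : (1 : ZMod l) ≠ 0 := one_ne_zero
  rw [inN_left, toAdd_ofAdd, cvec_apply, if_neg (fun h => h1 (by linear_combination -h)), if_pos rfl, zero_sub,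
    map_neg, map_one, neg_eq_zero] at hk
  exact h1 hk

/-- **Distinct inertia lines are distinct modulo `Ker`**: `D_k · Ker = D_j · Ker ⇒ k = j`. [claim: Mochizuki2012, status: disputed] -/
theorem eq_of_line_sup_modLKer_eq (h5 : 5 ≤ l) {k j : ZMod l}
    (h : Dm l k ⊔ (datum l h5).modLKer = Dm l j ⊔ (datum l h5).modLKer) : k = j := by
  by_contra hkj
  have h1 : (1 : ZMod l) ≠ 0 := fun h0 => by
    have := neg_natCast_ne_zero l (j := 1) one_pos (by omega)
    rw [Nat.cast_one, h0, neg_zero] at this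
    exact this rfl
  have h2 : (2 : ZMod l) ≠ 0 := fun h0 => by
    have := neg_natCast_ne_zero l (j := 2) two_pos (by omega)
    rw [Nat.cast_two, h0, neg_zero] at this
    exact this rfl
  -- a third label
  obtain ⟨m, hmk, hmj⟩ : ∃ m : ZMod l, m ≠ k ∧ m ≠ j := by
    by_cases hj : j = k + 1
    · refine ⟨k + 2, fun h => h2 (by linear_combination h), fun h => h1 (by rw [hj] at h; linear_combination h)⟩
    · exact ⟨k + 1, fun h => h1 (by linear_combination h), fun h => hj h.symm⟩
  have hle := line_inf_sup_le_modLKer l h5 (fun _ : Unit => j) (k := k) (m := m) (Ne.symm hmk)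
    (fun _ => Ne.symm hkj) (fun _ => Ne.symm hmj)
  have hmem : inN l (cvec l k) ∈ Dm l k := ⟨Multiplicative.ofAdd 1, by rw [inertiaHom_apply, toAdd_ofAdd, one_smul]⟩
  have hmem' : inN l (cvec l k) ∈ Dm l j ⊔ (datum l h5).modLKer := h ▸ Subgroup.mem_sup_left hmem
  refine inN_cvec_not_mem_modLKer l h5 k (hle ⟨hmem, ?_⟩)
  rw [sup_comm] at hmem'
  exact (sup_le_sup_left (le_iSup (fun _ : Unit => Dm l j) ()) _) hmem'

/-! ### Genuine side: inertia under the cusp action, and (L4) -/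

variable {D' : PuncturedEllipticData.{u}} {gens : Fin 2 → ↥(D'.PiX ⊓ D'.DeltaC)}
  (hfree : IsFreeProOn ↥(D'.PiX ⊓ D'.DeltaC) Set.univ gens) (F : ↥(D'.PiX ⊓ D'.DeltaC) →* P l)
  (hF : Continuous F) (h0 : F (gens 0) = elA l 1) (h1 : F (gens 1) = inN l (δ l 0))
  (hb : (gens 1 : D'.PiC) ∈ D'.PiCbar) (C : D'.CuspGalois) (hX : D'.PiXbar.relIndex D'.PiX = D'.l)

omit [Fact l.Prime] in
/-- `(t g)·I_x·(t g)⁻¹ = I_{g·x}` for some `t ∈ Π_X̲` (`CuspGalois.act_decomp` met with the normal `Δ_C`). ([IUTchI] §1 p.37)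
[claim: Mochizuki2012, status: disputed] -/
theorem exists_conj_inertia_eq (C : D'.CuspGalois) (g : D'.PiC) (x : D'.Cusp) :
    ∃ t ∈ D'.PiXbar, MulAut.conj (t * g) • D'.inertia x = D'.inertia (C.act g x) := by
  obtain ⟨t, ht, h⟩ := C.act_decomp g x
  refine ⟨t, ht, ?_⟩
  haveI : D'.DeltaC.Normal := inferInstanceAs D'.E.geom.Normal
  change MulAut.conj (t * g) • (D'.decomp x ⊓ D'.DeltaC) = D'.decomp (C.act g x) ⊓ D'.DeltaC
  rw [Subgroup.smul_inf, h, Subgroup.Normal.conj_smul_eq_self]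

omit [Fact l.Prime] in
/-- **(L4) ⇒ `Π_X̲`-conjugation does not move cusp inertia modulo `Ker`**: `t I_y t⁻¹ · Ker = I_y · Ker` for `t ∈ Π_X̲`.
([IUTchI] §1 p.38) [claim: Mochizuki2012, status: disputed] -/
theorem conj_inertia_sup_modLKer_eq (hL4 : ∀ x : D'.Cusp, ∀ g ∈ D'.PiXbar, ∀ z ∈ D'.inertia x, g * z * g⁻¹ * z⁻¹ ∈ D'.modLKer)
    (y : D'.Cusp) {t : D'.PiC} (ht : t ∈ D'.PiXbar) :
    MulAut.conj t • D'.inertia y ⊔ D'.modLKer = D'.inertia y ⊔ D'.modLKer := by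
  refine le_antisymm (sup_le ?_ le_sup_right) (sup_le ?_ le_sup_right)
  · intro x hx
    obtain ⟨z, hz, rfl⟩ := (Subgroup.mem_smul_pointwise_iff_exists x (MulAut.conj t) (D'.inertia y)).1 hx
    rw [MulAut.smul_def, MulAut.conj_apply, show t * z * t⁻¹ = (t * z * t⁻¹ * z⁻¹) * z by group]
    exact Subgroup.mul_mem _ (Subgroup.mem_sup_right (hL4 y t ht z hz)) (Subgroup.mem_sup_left hz)
  · intro z hz
    have hk : t * z⁻¹ * t⁻¹ * z⁻¹⁻¹ ∈ D'.modLKer := hL4 y t ht z⁻¹ (Subgroup.inv_mem _ hz)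
    have hw : t * z * t⁻¹ ∈ MulAut.conj t • D'.inertia y := by
      rw [← MulAut.conj_apply, ← MulAut.smul_def]; exact Subgroup.smul_mem_pointwise_smul _ _ _ hz
    rw [show z = (t * z * t⁻¹) * (t * z⁻¹ * t⁻¹ * z⁻¹⁻¹) by group]
    exact Subgroup.mul_mem _ (Subgroup.mem_sup_left hw) (Subgroup.mem_sup_right hk)

/-! ### The label of `a^i · x₀` -/

include hfree hF h0 h1 hb C hX in
/-- **The label of the cusp `a^i · x₀` is `i + κ x₀`.** ([IUTchI] §1 p.37) [claim: Mochizuki2012, status: disputed] -/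
theorem label_act_pow (h5 : 5 ≤ l) (hl : D'.l = l)
    (hL4 : ∀ x : D'.Cusp, ∀ g ∈ D'.PiXbar, ∀ z ∈ D'.inertia x, g * z * g⁻¹ * z⁻¹ ∈ D'.modLKer)
    {g : D'.Cusp → D'.PiC} (hg : ∀ x, g x ∈ D'.PiX ⊓ D'.DeltaC)
    (hIg : ∀ x, D'.inertia x = (Subgroup.zpowers (g x * ((gens 0 : D'.PiC) * (gens 1 : D'.PiC) *
      (gens 0 : D'.PiC)⁻¹ * (gens 1 : D'.PiC)⁻¹) * (g x)⁻¹)).topologicalClosure) (x₀ : D'.Cusp) (i : ℕ) :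
    ArrowModel.cuspAct l (toDih l (F ⟨g (C.act ((gens 0 : D'.PiC) ^ i) x₀), hg _⟩).right) 0 =
      (i : ZMod l) + ArrowModel.cuspAct l (toDih l (F ⟨g x₀, hg x₀⟩).right) 0 := by
  classical
  set y := C.act ((gens 0 : D'.PiC) ^ i) x₀ with hy
  set c : D'.PiC := (gens 0 : D'.PiC) * (gens 1 : D'.PiC) * (gens 0 : D'.PiC)⁻¹ * (gens 1 : D'.PiC)⁻¹ with hc
  -- the conjugate `J = a^i I_{x₀} a^{-i}` and its conjugator `w = a^i g₀ ∈ Δ_X′`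
  set w : ↥(D'.PiX ⊓ D'.DeltaC) := gens 0 ^ i * ⟨g x₀, hg x₀⟩ with hw
  have hwval : (w : D'.PiC) = (gens 0 : D'.PiC) ^ i * g x₀ := by rw [hw, Subgroup.coe_mul, Subgroup.coe_pow]
  set J : Subgroup D'.PiC := (Subgroup.zpowers ((w : D'.PiC) * c * (w : D'.PiC)⁻¹)).topologicalClosure with hJ
  have hJconj : J = MulAut.conj ((gens 0 : D'.PiC) ^ i) • D'.inertia x₀ := by
    rw [hIg x₀, conj_smul_topologicalClosure_zpowers, hJ, hwval]
    congr 2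
    simp only [mul_assoc, mul_inv_rev]
  obtain ⟨t, ht, hty⟩ := exists_conj_inertia_eq C ((gens 0 : D'.PiC) ^ i) x₀
  rw [← hy, map_mul, mul_smul, ← hJconj] at hty
  -- `J · Ker = I_y · Ker` by (L4)
  have hJsup : J ⊔ D'.modLKer = D'.inertia y ⊔ D'.modLKer := by
    have h := conj_inertia_sup_modLKer_eq hL4 y (D'.PiXbar.inv_mem ht)
    rw [← hty, ← mul_smul, ← map_mul, inv_mul_cancel, map_one, one_smul] at h
    rw [hty] at h
    exact h
  -- both sides lie between `Ker′` and `Δ_X̲′`; apply `F`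
  have hIle : ∀ x, D'.inertia x ≤ D'.PiX ⊓ D'.DeltaC := fun x => (D'.inertia_le_deltaXbar x).trans deltaXbar_le_deltaX
  have hJle : J ≤ D'.PiX ⊓ D'.DeltaC := by
    rw [hJ]
    refine Subgroup.topologicalClosure_minimal _ ?_ D'.isClosed_piX_inf_deltaC
    rw [Subgroup.zpowers_le]
    refine Subgroup.mul_mem _ (Subgroup.mul_mem _ w.2 ?_) (Subgroup.inv_mem _ w.2)
    rw [hc]
    exact Subgroup.mul_mem _ (Subgroup.mul_mem _ (Subgroup.mul_mem _ (gens 0).2 (gens 1).2)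
      (Subgroup.inv_mem _ (gens 0).2)) (Subgroup.inv_mem _ (gens 1).2)
  have hΦle : D'.modLKer ≤ D'.PiX ⊓ D'.DeltaC := D'.modLKer_le_deltaXbar.trans deltaXbar_le_deltaX
  have himg := congrArg (fun H : Subgroup D'.PiC => (H.subgroupOf (D'.PiX ⊓ D'.DeltaC)).map F) hJsup
  rw [subgroupOf_sup_of_le hJle hΦle, subgroupOf_sup_of_le (hIle y) hΦle, Subgroup.map_sup, Subgroup.map_sup,
    map_modLKer_eq l hfree F hF h0 h1 hb C hX h5 hl, map_inertia_eq l F hF h0 h1 w.2 hJ,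
    map_inertia_eq l F hF h0 h1 (hg y) (hIg y)] at himg
  have hlab := eq_of_line_sup_modLKer_eq l h5 himg
  -- the label of `w = a^i g₀` is `i + κ x₀`
  rw [← hlab, cuspAct_toDih_zero l hfree F hF h0 h1, cuspAct_toDih_zero l hfree F hF h0 h1]
  have hwF : F ⟨(w : D'.PiC), w.2⟩ = elA l 1 ^ i * F ⟨g x₀, hg x₀⟩ := by
    rw [show (⟨(w : D'.PiC), w.2⟩ : ↥(D'.PiX ⊓ D'.DeltaC)) = w from rfl, hw, map_mul, map_pow, h0]
  rw [hwF, right_left_mul l (Subgroup.pow_mem _ (elA_mem_PiXm l 1) i), toAdd_mul, map_add, ← elA_nsmul, mul_one]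
  change PadicInt.toZMod (Multiplicative.toAdd (Multiplicative.ofAdd (i : ℤ_[l]))) + _ = _
  rw [toAdd_ofAdd, map_natCast]

include hfree hF h0 h1 hb C hX in
/-- **The shadow labels are injective, with NO extra law** (surjective by `label_act_pow`, and `#Cusp = l`).
([IUTchI] §1 p.37) [claim: Mochizuki2012, status: disputed] -/
theorem label_injective (h5 : 5 ≤ l) (hl : D'.l = l)
    (hL4 : ∀ x : D'.Cusp, ∀ g ∈ D'.PiXbar, ∀ z ∈ D'.inertia x, g * z * g⁻¹ * z⁻¹ ∈ D'.modLKer)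
    {g : D'.Cusp → D'.PiC} (hg : ∀ x, g x ∈ D'.PiX ⊓ D'.DeltaC)
    (hIg : ∀ x, D'.inertia x = (Subgroup.zpowers (g x * ((gens 0 : D'.PiC) * (gens 1 : D'.PiC) *
      (gens 0 : D'.PiC)⁻¹ * (gens 1 : D'.PiC)⁻¹) * (g x)⁻¹)).topologicalClosure) :
    Function.Injective fun x => ArrowModel.cuspAct l (toDih l (F ⟨g x, hg x⟩).right) 0 := by
  classical
  haveI : NeZero l := ⟨(Fact.out : l.Prime).ne_zero⟩
  haveI : Finite D'.Cusp := C.finite_cusp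
  letI : Fintype D'.Cusp := Fintype.ofFinite _
  haveI : Nonempty D'.Cusp := ⟨D'.ε0⟩
  have hcard : Fintype.card D'.Cusp = Fintype.card (ZMod l) := by
    rw [← Nat.card_eq_fintype_card, C.card_cusp, hX, hl, ZMod.card]
  refine (Finite.injective_iff_surjective_of_equiv (Fintype.equivOfCardEq hcard)).2 fun k => ?_
  set x₀ := D'.ε0
  refine ⟨C.act ((gens 0 : D'.PiC) ^ (k - ArrowModel.cuspAct l (toDih l (F ⟨g x₀, hg x₀⟩).right) 0).val) x₀, ?_⟩
  rw [label_act_pow l hfree F hF h0 h1 hb C hX h5 hl hL4 hg hIg, ZMod.natCast_zmod_val, sub_add_cancel]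

end ProLModel

/-! ### (L2a), (L2c) and the law (I) at a genuine `GeomOrigin` datum, with no extra law -/

namespace GeomOrigin

open Literature.AnabelianGeometry.AbsoluteAnabelian ProLModel
open scoped Pointwise

variable {D : PuncturedEllipticData.{u}}

/-- The standard shadow data of a `GeomOrigin` datum with a cusp action: a standard free basis, a shadow `F`, and INJECTIVE
labels `κ` with `F(I_x) = D_{κ x}` — injectivity from (L4) = `GeomOrigin.inertia_central O C`. ([IUTchI] §1 p.37)
[claim: Mochizuki2012, status: disputed] -/
theorem exists_shadow_labels_of_cuspGalois (O : D.GeomOrigin) (C : D.CuspGalois) (hl : D.l.Prime)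
    (hX : D.PiXbar.relIndex D.PiX = D.l) :
    haveI : Fact D.l.Prime := ⟨hl⟩
    ∃ (gens : Fin 2 → ↥(D.PiX ⊓ D.DeltaC)) (F : ↥(D.PiX ⊓ D.DeltaC) →* P D.l) (κ : D.Cusp → ZMod D.l),
      IsFreeProOn ↥(D.PiX ⊓ D.DeltaC) Set.univ gens ∧ Continuous F ∧ F (gens 0) = elA D.l 1 ∧
        F (gens 1) = inN D.l (δ D.l 0) ∧ (gens 1 : D.PiC) ∈ D.PiCbar ∧
        (∀ x, ((D.inertia x).subgroupOf (D.PiX ⊓ D.DeltaC)).map F = Dm D.l (κ x)) ∧ Function.Injective κ := by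
  haveI : Fact D.l.Prime := ⟨hl⟩
  obtain ⟨gens, hfree, hb, hcusp⟩ := O.exists_standard_gens C hl hX
  obtain ⟨F, hF, h0, h1⟩ := exists_shadowHom D.l D hfree (elA D.l 1) (inN D.l (δ D.l 0))
  choose g hg hIg using hcusp
  exact ⟨gens, F, fun x => ArrowModel.cuspAct D.l (toDih D.l (F ⟨g x, hg x⟩).right) 0, hfree, hF, h0, h1, hb,
    fun x => map_inertia_eq D.l F hF h0 h1 (hg x) (hIg x),
    label_injective D.l hfree F hF h0 h1 hb C hX D.five_le rfl (GeomOrigin.inertia_central O C) hg hIg⟩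

/-- **(L2c) at a genuine datum, NO extra law — «a natural exact sequence `0 → I_ε′ × I_ε″ → Δ_ε`» (p. 37 l. 34)**:
abc-iut-L5-t1's field `ModLCuspLaws.inertia_images_inf_le` / the binder `hL2c` of the Cor. 1.2 closers, DERIVED from the
origin record (A) (c′), a cusp action, `l` prime and `[Π_X : Π_X̲] = l`. ([IUTchI] §1 p.37) [claim: Mochizuki2012, status: disputed] -/
theorem inertia_images_inf_le_of_cuspGalois (O : D.GeomOrigin) (C : D.CuspGalois) (hl : D.l.Prime)
    (hX : D.PiXbar.relIndex D.PiX = D.l) :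
    D.inertia D.ε1 ⊓ (D.inertia D.ε2 ⊔ D.deltaEpsKer) ≤ D.deltaEpsKer := by
  haveI : Fact D.l.Prime := ⟨hl⟩
  obtain ⟨gens, F, κ, hfree, hF, h0, h1, hb, hκ, hinj⟩ := O.exists_shadow_labels_of_cuspGalois C hl hX
  exact inertia_images_inf_le_of_shadow D.l hfree F hF h0 h1 hb C hX D.five_le rfl hκ hinj

/-- **(L2a) at a genuine datum, NO extra law — «noncanonical isomorphisms `I_ε′ ≅ ℤ/lℤ`» in `Δ_ε` (p. 37 l. 36)**:
abc-iut-L5-t1's field `ModLCuspLaws.inertia_ε1_image_order` / the binder `hL2a` of the Cor. 1.2 closers, DERIVED from (A)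
(c′), a cusp action, `l` prime and `[Π_X : Π_X̲] = l`. ([IUTchI] §1 p.37) [claim: Mochizuki2012, status: disputed] -/
theorem inertia_ε1_image_order_of_cuspGalois (O : D.GeomOrigin) (C : D.CuspGalois) (hl : D.l.Prime)
    (hX : D.PiXbar.relIndex D.PiX = D.l) :
    D.deltaEpsKer.relIndex (D.inertia D.ε1 ⊔ D.deltaEpsKer) = D.l := by
  haveI : Fact D.l.Prime := ⟨hl⟩
  obtain ⟨gens, F, κ, hfree, hF, h0, h1, hb, hκ, hinj⟩ := O.exists_shadow_labels_of_cuspGalois C hl hX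
  exact inertia_ε1_image_order_of_shadow D.l hfree F hF h0 h1 hb C hX D.five_le rfl hκ hinj

/-- **The law (I) «distinct cusps of `X̲` have non-`Π_X̲`-conjugate inertia groups» is itself a THEOREM** of the origin
record, a cusp action, `l` prime and `[Π_X : Π_X̲] = l` (conjugate inertia ⇒ equal lines modulo `Ker` by (L4) ⇒ equal
labels ⇒ equal cusps). ([IUTchI] §1 p.37) [claim: Mochizuki2012, status: disputed] -/
theorem inertia_conj_injective (O : D.GeomOrigin) (C : D.CuspGalois) (hl : D.l.Prime)
    (hX : D.PiXbar.relIndex D.PiX = D.l) :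
    ∀ (x y : D.Cusp) (t : D.PiC), t ∈ D.PiXbar → MulAut.conj t • D.inertia x = D.inertia y → x = y := by
  haveI : Fact D.l.Prime := ⟨hl⟩
  intro x y t ht hxy
  obtain ⟨gens, F, κ, hfree, hF, h0, h1, hb, hκ, hinj⟩ := O.exists_shadow_labels_of_cuspGalois C hl hX
  have hIle : ∀ x, D.inertia x ≤ D.PiX ⊓ D.DeltaC := fun x => (D.inertia_le_deltaXbar x).trans deltaXbar_le_deltaX
  have hΦle : D.modLKer ≤ D.PiX ⊓ D.DeltaC := D.modLKer_le_deltaXbar.trans deltaXbar_le_deltaX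
  have hsup := conj_inertia_sup_modLKer_eq (GeomOrigin.inertia_central O C) x ht
  rw [hxy] at hsup
  have himg := congrArg (fun H : Subgroup D.PiC => (H.subgroupOf (D.PiX ⊓ D.DeltaC)).map F) hsup
  rw [subgroupOf_sup_of_le (hIle y) hΦle, subgroupOf_sup_of_le (hIle x) hΦle, Subgroup.map_sup, Subgroup.map_sup,
    map_modLKer_eq D.l hfree F hF h0 h1 hb C hX D.five_le rfl, hκ, hκ] at himg
  exact (hinj (eq_of_line_sup_modLKer_eq D.l D.five_le himg)).symm

end GeomOrigin

end PuncturedEllipticData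

end Literature.IUT.HodgeTheaters
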